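/-
Copyright (c) 2026 the pub-hodgecm-mathlib formalisation cell (harness21).  Prover seat hodgecm-mathlib-K2E3-p32 (g0), HCML Track B «K2-LIT» (close-out strike line L4
`stub_StCharTS`), h413 = `stmt-HodgeConjecture-24833`, line `K2_E3_EllipticInputs`, unit U4 «Keys», PART «U4Keys» socket :155 (U4f-χ₁-ram-one-d0B)
`sig_K2E3KeysThmTwoContractingRamifiedCharOneDepthZeroNormTrivial` (LINE-LEAD K2E3-plan (g4) EMIT #5, deal D162, cell «U4-RAM»; plan of record K2E3-p06 (g4) DESIGN-M2-v2 (O2),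
step Z2-B «the type plane in Branch B»), CM ASSEMBLY of the letters: THE NORMALISED `(I, χ̃)`-TYPE BASIS `(f₁, f_w)` OF `i(χ₁, 1)` ON `U(Φ₃)(L⁺_v)` EXISTS at depth zero in
Branch B (`f_w` is the vector that does not exist in Branch A).  2026-09-04.
-/
import Summits.HodgeConjecture.HodgeConjecture.Theorems.K2E3BranchBTypeLettersCM       -- ★ (this seat) `theta_eq_tau_weylConj_of_mem` (`hθw`); brings ★ Z2A-3c (iii) `theta_eq_tau_of_mem` (`hθH`), ★ Z2A-3b `theta_mul`, `map_weyl_eq_weylLongU`, the frame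
import Summits.HodgeConjecture.HodgeConjecture.Theorems.K2E3BranchBPrincipalLevelCM   -- ★∕📤 (this seat) `exists_isOpen_subgroup_theta_eq_one` (`C`, `hCo`, `hθC`)
import Summits.HodgeConjecture.HodgeConjecture.Theorems.K2E3IwahoriTypeBasisMackey    -- ★ (this seat) `exists_normalised_typeBasis_of_fin_two` (MACKEY)
import Summits.HodgeConjecture.HodgeConjecture.Theorems.F0P3cStCharTSStLevelsPF         -- ★ (K2E3-p05) `cover_borel_I`, `disj_borel_I` (`U(Φ₃)(L⁺_v) = P·I ⊔ P·w̃·I`)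
import HarnessLib

/-!
# K2 ∕ E3 «EllipticInputs», unit U4 «Keys» — (U4f-χ₁-ram-one-d0B) step Z2-B, CM ASSEMBLY: THE NORMALISED `(I, χ̃)`-TYPE BASIS `(f₁, f_w)` OF `i(χ₁, 1)` ON `U(Φ₃)(L⁺_v)`
# «depth zero + BRANCH B (`χ₁(u·σu) = 1` on units) ⟹ ∃ f₁ f_w ∈ i(χ₁,1), `(I, χ̃)`-eigen, `f₁(1) = 1, f₁(w₀) = 0, f_w(1) = 0, f_w(w₀) = 1`»   [Roche1998 §3–§4; Keys1984 §7 Thm (2); Casselman1995 §6.3]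

Cell `pub/hodgecm-mathlib`, crux H413 = `stmt-HodgeConjecture-24833`, route of record `HCCMUnconditional`; chair K2-lead (g2), LINE-LEAD∕dealer K2E3-plan (g4), architect K2E3-p25
(g3); cell «U4-RAM».  THEOREMS ONLY (no `def`, no `instance`, no `notation`, no named-fact hypothesis, no `sorry`); lane `--supports stmt-HodgeConjecture-24833 --as helper`,
count-neutral.  NOT THE PAYER: the socket :155 stays OPEN.

THE POINT (DESIGN-M2-v2 (O2) «BRANCH B: type plane `ℂf₁ ⊕ ℂf_w`»; PAPER-Z3 §0 «TYPE BASIS»).  ★ MACKEY `K2E3IwahoriTypeBasisMackey.exists_normalised_typeBasis_of_fin_two` (this seat, generic)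
with every letter discharged on `G = U(Φ₃)(L⁺_v)`, `H = P` (the Borel of ★ `cmBorelTriple`), `K = I` (the Iwahori of K2E3-p06 (g4)'s frame `(eA, heA, ϖ, g₁, K0, K1, I)`), `τ` the
inducing line `((χ₁, 1) ∘ proj) ⊗ δ^{1∕2}` of ★ `cmPrincipalSeries L 3 v (cmTorusCharPair L v χ₁ 1)`, `θ(g) = χ₁(g₀₀)` (the depth-zero Iwahori character, `dif`-spelling of ★ Z2A-5),
`g₀ = w₀` (matrix `Φ₃`, `hw₀`): `hKo` ★ `isOpen_isCompact_levels`; `hθmul` ★ Z2A-3b `theta_mul` (depth zero); `hθone` (`1₀₀ = 1`, `χ₁ 1 = 1`); `(C, hCo, hθC)` ★∕📤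
`K2E3BranchBPrincipalLevelCM.exists_isOpen_subgroup_theta_eq_one` (depth zero); `hcover'`, `hdisj'` ★ `F0P3cStCharTSStLevelsPF.cover_borel_I` ∕ `disj_borel_I` (`w̃ = eA⁻¹(w) = w₀` by ★
`map_weyl_eq_weylLongU`); `hθH` ★ Z2A-3c (iii) `theta_eq_tau_of_mem`; `hθw` ★ `K2E3BranchBTypeLettersCM.theta_eq_tau_weylConj_of_mem` (BRANCH B, `hB`).
* **`exists_normalised_typeBasis_of_depthZero_of_normChar_eq_one`** — the normalised `(I, χ̃)`-type basis `(f₁, f_w)` of `i(χ₁, 1)` at depth zero in Branch B.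
With ★ `K2E3BranchBDeterminantVanishing.det_intertwiningIntegral_eq_zero_of_typeVector` (this seat) and ★ V1∕Z2A-2∕V2b (the type vector in `V`), the remaining input of «reducible ⟹
`det M = 0`» on `U(Φ₃)(L⁺_v)` is the integrability of the four cell integrals `∫_N fᵢ(w₀ n g) dn`, `g ∈ {1, w₀}` (Z3, analytic).
HONEST LABEL.  HC_CM is proved only modulo the 7 printed citations (2 remaining named inputs: hLiu418 = `stmt-HodgeConjecture-24832`, h413 = `stmt-HodgeConjecture-24833`) until rung 0
closes; count-neutral — this file does NOT pay the leaf; no printed citation is discharged.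

## References
* [Roche1998] A. Roche, Ann. Sci. ÉNS (4) 31 (1998), §3–§4 (`|W_χ| = 2`: the two-dimensional Hecke module of the type).
* [Keys1984] D. Keys, Compositio Math. 51 (1984), §3, §7 Theorem (2) p. 126.
* [Casselman1995] W. Casselman, *Introduction to the theory of admissible representations of `p`-adic reductive groups* (1995), §6.3.
* [BernsteinZelevinsky1977] I. N. Bernstein, A. V. Zelevinsky, Ann. Sci. ÉNS 10 (1977), §2.3.
-/

set_option autoImplicit false
-- the mandated namespace has the single-problem summit's repeated segment (`HodgeConjecture.HodgeConjecture`)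
set_option linter.dupNamespace false

noncomputable section

open NumberField IsDedekindDomain
open scoped Matrix MatrixGroups WithZero Valued
open Literature.NumberTheory Literature.NumberTheory.Automorphic Literature.NumberTheory.Automorphic.UnitaryGroup
open Literature.NumberTheory.Rogawski1990

namespace Summit.HodgeConjecture.HodgeConjecture.Cruxes.H413.K2E3BranchBTypeBasisCM

open Summit.HodgeConjecture.HodgeConjecture.Cruxes.H413
open Summit.HodgeConjecture.HodgeConjecture.Cruxes.H413.K2E3DepthZeroIwahoriCharacterCM
open Summit.HodgeConjecture.HodgeConjecture.Cruxes.H413.K2E3BranchATorusWitnessCM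
open Summit.HodgeConjecture.HodgeConjecture.Cruxes.H413.K2E3BranchATypeLettersCM

variable (L : Type) [Field L] [NumberField L] [IsCMField L] (v : HeightOneSpectrum (𝓞 ↥(maximalRealSubfield L)))
  (w : PlacesOver L v) (hw : IsCMField.complexConj L • w.1 = w.1)
  (eA : Gqs L v ≃ₜ* ↥(unitaryGroupOfForm (galAdicCompletionMap (L := L) (IsCMField.complexConj L) hw) ((StdForm.antidiagonal 3).over (w.1.adicCompletion L))))
  (heA : ∀ g : Gqs L v,
    ((eA g : ↥(unitaryGroupOfForm (galAdicCompletionMap (L := L) (IsCMField.complexConj L) hw) ((StdForm.antidiagonal 3).over (w.1.adicCompletion L)))) :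
        GL (Fin 3) (w.1.adicCompletion L)) =
      ((localNonsplitEquiv (IsCMField.complexConj L) (qsForm L) (IsCMField.complexConj_ne_one L) w hw g :
        ↥(unitaryGroupOfForm (galAdicCompletionMap (L := L) (IsCMField.complexConj L) hw) (placeForm (qsForm L) w.1))) : GL (Fin 3) (w.1.adicCompletion L)))
  {ϖ : w.1.adicCompletion L} (hϖ : Valued.v ϖ = WithZero.exp (-1 : ℤ))
  (g₁ : GL (Fin 3) (w.1.adicCompletion L)) (hg₁ : (g₁ : Matrix (Fin 3) (Fin 3) (w.1.adicCompletion L)) = Matrix.diagonal ![(1 : w.1.adicCompletion L), 1, ϖ])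
  (K0 K1 I : Subgroup (Gqs L v))
  (hK0 : K0 = ((glInt 3 (w.1.adicCompletion L)).subgroupOf
    (unitaryGroupOfForm (galAdicCompletionMap (L := L) (IsCMField.complexConj L) hw) ((StdForm.antidiagonal 3).over (w.1.adicCompletion L)))).comap
      eA.toMulEquiv.toMonoidHom)
  (hK1 : K1 = (((glInt 3 (w.1.adicCompletion L)).map (MulAut.conj g₁).toMonoidHom).subgroupOf
    (unitaryGroupOfForm (galAdicCompletionMap (L := L) (IsCMField.complexConj L) hw) ((StdForm.antidiagonal 3).over (w.1.adicCompletion L)))).comap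
      eA.toMulEquiv.toMonoidHom)
  (hI : I = K0 ⊓ K1)
  (w₀ : Gqs L v) (hw₀ : Units.val (w₀.val : GL (Fin 3) (LocalRing L v)) = cmLocalForm L 3 v)

/-! ## The normalised `(I, χ̃)`-type basis of `i(χ₁, 1)` at depth zero in Branch B -/

open Classical in
include hw heA hϖ hg₁ hK0 hK1 hI hw₀ in
set_option maxHeartbeats 8000000 in
set_option synthInstance.maxHeartbeats 400000 in
-- the `SmoothInd` carrier of `cmPrincipalSeries` with the `dif`-character on `Gqs L v` read in two definitionally equal carriers (class of ★ Z2A-5)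
/-- **THE NORMALISED `(I, χ̃)`-TYPE BASIS `(f₁, f_w)` OF `i(χ₁, 1)` ON `U(Φ₃)(L⁺_v)`, DEPTH ZERO, BRANCH B.**  `v` non-split; `χ₁ : (L ⊗ L⁺_v)ˣ → ℂˣ` trivial on the principal units
(`hdepth`) with `χ₁(u·σu) = 1` for every unit `u` with `|u_{w′}| = 1` (`hB`: BRANCH B, `w₀ ∈ W_χ`); `w₀` the element of matrix `Φ₃`.  Then there are sections `f₁, f_w` of
`i(χ₁, 1) = Ind_P^G ((χ₁,1)∘proj ⊗ δ^{1∕2})` with `b·f = χ₁(b₀₀)·f` for `b ∈ I` (the depth-zero `(I, χ̃)`-type) and `f₁(1) = 1, f₁(w₀) = 0, f_w(1) = 0, f_w(w₀) = 1` — ★ MACKEY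
`exists_normalised_typeBasis_of_fin_two` with the letters ★ `theta_mul`, ★∕📤 `exists_isOpen_subgroup_theta_eq_one`, ★ `cover_borel_I`∕`disj_borel_I` (+ ★ `map_weyl_eq_weylLongU`), ★
`theta_eq_tau_of_mem`, ★ `theta_eq_tau_weylConj_of_mem`. [cite: Roche1998, §3–§4] [cite: Keys1984, §7 Theorem (2) p. 126] [cite: Casselman1995, §6.3] [cite: BernsteinZelevinsky1977, §2.3] -/
theorem exists_normalised_typeBasis_of_depthZero_of_normChar_eq_one (χ₁ : (LocalRing L v)ˣ →* ℂˣ)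
    (hdepth : ∀ u : (LocalRing L v)ˣ, (∀ w' : PlacesOver L v, Valued.v (((u : LocalRing L v) w') - 1) < 1) → χ₁ u = 1)
    (hB : ∀ u : (LocalRing L v)ˣ, (∀ w' : PlacesOver L v, Valued.v ((u : LocalRing L v) w') = 1) →
      χ₁ (u * Units.map (conjLocal L (IsCMField.complexConj L) v : LocalRing L v →* LocalRing L v) u) = 1) :
    haveI := locallyCompactSpace_cmBorelU L 3 v
    ∃ f₁ f_w : Representation.SmoothInd (cmBorelTriple L 3 v).P
        (Representation.twist (((Representation.trivial ℂ ↥(torusU (conjLocal L (IsCMField.complexConj L) v) (cmLocalForm L 3 v)) ℂ).twist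
          (cmTorusCharPair L v χ₁ 1)).comp (cmBorelTriple L 3 v).proj) (rootDeltaChar (cmBorelTriple L 3 v).P)),
      (∀ x ∈ I, Representation.smoothIndRep _ _ x f₁ =
        (if h : IsUnit (((x.val : GL (Fin 3) (LocalRing L v)) : Matrix (Fin 3) (Fin 3) (LocalRing L v)) 0 0) then ((χ₁ h.unit : ℂˣ) : ℂ) else 0) • f₁) ∧
      (∀ x ∈ I, Representation.smoothIndRep _ _ x f_w =
        (if h : IsUnit (((x.val : GL (Fin 3) (LocalRing L v)) : Matrix (Fin 3) (Fin 3) (LocalRing L v)) 0 0) then ((χ₁ h.unit : ℂˣ) : ℂ) else 0) • f_w) ∧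
      f₁.toFun 1 = 1 ∧ f₁.toFun (w₀ : ↥(unitaryGroupOfForm (conjLocal L (IsCMField.complexConj L) v) (cmLocalForm L 3 v))) = 0 ∧
      f_w.toFun 1 = 0 ∧ f_w.toFun (w₀ : ↥(unitaryGroupOfForm (conjLocal L (IsCMField.complexConj L) v) (cmLocalForm L 3 v))) = 1 := by
  haveI := locallyCompactSpace_cmBorelU L 3 v
  -- the structural instances of the carrier, synthesised once here (inside the MACKEY application the two spellings of the carrier make instance search time out)
  haveI hTG : IsTopologicalGroup ↥(unitaryGroupOfForm (conjLocal L (IsCMField.complexConj L) v) (cmLocalForm L 3 v)) := inferInstance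
  have hlev := F0P3cStCharTSStLevelsTransport.isOpen_isCompact_levels L v w hw eA g₁ K0 K1 I hK0 hK1 hI
  -- the depth-zero level letter `(C, hCo, hθC)`
  obtain ⟨C, hCo, -, hθC⟩ := K2E3BranchBPrincipalLevelCM.exists_isOpen_subgroup_theta_eq_one L v w hw eA heA hϖ g₁ hg₁ K0 K1 I hK0 hK1 hI χ₁ hdepth
  -- `θ 1 = 1`
  have h1unit : IsUnit ((((1 : Gqs L v).val : GL (Fin 3) (LocalRing L v)) : Matrix (Fin 3) (Fin 3) (LocalRing L v)) 0 0) :=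
    isUnit_apply_zero_zero_of_mem L v w hw eA heA hϖ g₁ hg₁ K0 K1 I hK0 hK1 hI I.one_mem
  have hθone : (if h : IsUnit ((((1 : Gqs L v).val : GL (Fin 3) (LocalRing L v)) : Matrix (Fin 3) (Fin 3) (LocalRing L v)) 0 0) then ((χ₁ h.unit : ℂˣ) : ℂ) else 0) = 1 := by
    rw [dif_pos h1unit]
    have hu : h1unit.unit = 1 := Units.ext (by rw [IsUnit.unit_spec]; rfl)
    rw [hu, map_one, Units.val_one]
  -- the two Bruhat–Iwahori cells with `w̃ = eA⁻¹(w) = w₀`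
  have hwtilde : eA.symm (weylLongU (galAdicCompletionMap (L := L) (IsCMField.complexConj L) hw) (rfl : (StdForm.antidiagonal 3).over (w.1.adicCompletion L) = _)) = w₀ := by
    rw [← map_weyl_eq_weylLongU L v w hw eA heA w₀ hw₀, ContinuousMulEquiv.symm_apply_apply]
  have hcover' := F0P3cStCharTSStLevelsPF.cover_borel_I L v w hw eA heA hϖ g₁ hg₁ K0 K1 I hK0 hK1 hI
  have hdisj' := F0P3cStCharTSStLevelsPF.disj_borel_I L v w hw eA heA hϖ g₁ hg₁ K0 K1 I hK0 hK1 hI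
  rw [hwtilde] at hcover' hdisj'
  -- `@`-form: the carrier's instances are passed explicitly so that the openness facts (stated on `Gqs L v`) are accepted by definitional unfolding
  exact @K2E3IwahoriTypeBasisMackey.exists_normalised_typeBasis_of_fin_two _ _ _ hTG (cmBorelTriple L 3 v).P _ I hlev.2.2.1
    (fun g : ↥(unitaryGroupOfForm (conjLocal L (IsCMField.complexConj L) v) (cmLocalForm L 3 v)) =>
      if h : IsUnit (((g : GL (Fin 3) (LocalRing L v)) : Matrix (Fin 3) (Fin 3) (LocalRing L v)) 0 0) then ((χ₁ h.unit : ℂˣ) : ℂ) else 0)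
    (fun x hx y hy => theta_mul L v w hw eA heA hϖ g₁ hg₁ K0 K1 I hK0 hK1 hI χ₁ hdepth hx hy) hθone C hCo hθC _ hcover' hdisj'
    (fun s hsI hsP => theta_eq_tau_of_mem L v w hw eA heA hϖ g₁ hg₁ K0 K1 I hK0 hK1 hI χ₁ s hsP hsI)
    (fun s hsI hsP => K2E3BranchBTypeLettersCM.theta_eq_tau_weylConj_of_mem L v w hw eA heA hϖ g₁ hg₁ K0 K1 I hK0 hK1 hI w₀ hw₀ χ₁ hB s hsI hsP)

end Summit.HodgeConjecture.HodgeConjecture.Cruxes.H413.K2E3BranchBTypeBasisCM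

end
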